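import Summits.Ventures.YMGap.RobustBall.TrailLoopFamily
import Summits.Ventures.YMGap.RobustBall.WalkTranslation
import HarnessLib

/-!
# Venture YMGap, track ROBUST-BALL (tier 2) — TRANSLATION-INVARIANT generalized Wilson actions: a plain weighted
# `ℓ¹` norm on SHAPE couplings controls the loop-action norm

HONEST FRAMING. WHAT THIS IS: a venture file (cell `pub-ymgap`, track Y2 ROBUST-BALL, seat rb-p1), the
translation-invariant reading of `LoopActionMember.lean`: a family of loop SHAPES `σ : S → {closed walks at 0}` with
shape couplings `c₀ : S → ℝ` defines the translation-invariant action `∑_{x ∈ ℤ^d} ∑_s c₀(s) Re tr(U_{x + σ(s)})/N`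
(`loopFamilyAction N (shapeLoop σ) (c₀ ∘ snd)`, every shape translated to every base point). We prove
(i) finite carrier fibres from finite shape fibres and nontrivial shapes (`finite_fibre_shapeLoop`); (ii) THE NORM:
`‖c‖_w ≤ ∑_s |c₀(s)| · |σ s|² · e^{w D₀(s)}` for any `ℓ^∞`-diameter bounds `D₀` of the shapes (`loopNormLE_shapeLoop`;
each shape passes through a given link in at most `|σ s|` translated positions) — a PLAIN WEIGHTED `ℓ¹` NORM on shape
couplings, no supremum over links; (iii) the canonical instance of ALL nontrivial closed TRAIL SHAPES (`trailShape`,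
`D₀ = 2|s|`): for `SU(2)`, `d = 4`, `β_W = 1/16`, EVERY shape-coupling function with
`∑_s |c₀(s)| |s|² 4^{|s|} ≤ 0.143` gives a translation-invariant generalized Wilson action with unique DLR state and
exponential clustering (`su2_trailShapes_massGapS_1_16`); every `N ≥ 2` at 't Hooft `1/64` with
`∑_s |c₀(s)| |s|² (36/25)^{|s|} ≤ 1/40` (`suN_trailShapes_massGapS_1_64`). WHAT IT IS NOT: strong-coupling lattice
statements inside the rows' windows; nothing about the continuum limit or the Clay problem.

References: this track's `LoopActionMember.lean`, `TrailLoopFamily.lean`, `WalkTranslation.lean`; K. G. Wilson,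
Phys. Rev. D 10 (1974) 2445 (loop actions).
-/

noncomputable section

open Function SimpleGraph Real
open Literature.Probability.LatticeModels
open Literature.MathematicalPhysics.QuantumLattice
open Literature.MathematicalPhysics.QuantumFieldTheory (walkEdges card_walkEdges_le_length card_walkEdges_of_isTrail)
open Summit.QuantumFields.BalabanUV.InfraRed.StrongCouplingPoincareDoorSUN (OneLinkPoincareSUN)
open Summit.QuantumFields.BalabanUV.InfraRed.StrongCouplingVarianceDoorSUN (OneLinkVarianceBound)

namespace Summit.Ventures.YMGap.RobustBall

variable {d N : ℕ} {S : Type*}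

/-! ### Shapes translated everywhere -/

section Family

variable (σ : S → (zdGraph d).Walk (0 : Site d) 0)

/-- **The translation-invariant loop family of the shapes `σ`**: index `(x, s)` ↦ the shape `σ s` translated to the
base point `x` (tree `zdGraphShiftIso x`, Mathlib `Walk.map`). -/
def shapeLoop (i : Site d × S) : ZdLoop d :=
  ⟨(0 : Site d) + i.1, (σ i.2).map (zdGraphShiftIso i.1).toEmbedding.toHom⟩

/-- The links of a translated shape are the translated links. -/
theorem mem_walkEdges_shapeLoop_iff (i : Site d × S) (e : ZdEdge d) :
    e ∈ walkEdges (shapeLoop σ i).walk ↔ (e.1 - i.1, e.2) ∈ walkEdges (σ i.2) :=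
  mem_walkEdges_map_shift_iff i.1 (σ i.2) e

/-- The edge set of a translated shape is the translated edge set. -/
theorem walkEdges_shapeLoop (i : Site d × S) :
    walkEdges (shapeLoop σ i).walk = (walkEdges (σ i.2)).image fun e => (e.1 + i.1, e.2) :=
  walkEdges_map_shift i.1 (σ i.2)

/-- Translation preserves length. -/
theorem length_shapeLoop (i : Site d × S) : (shapeLoop σ i).walk.length = (σ i.2).length :=
  Walk.length_map _ _

/-- **Finite carrier fibres** of the translated family, from finite shape fibres and nontrivial shapes: a translate
with edge set `X` is based at an endpoint of a link of `X`, and its shape has edge set `X − x`. -/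
theorem finite_fibre_shapeLoop (hσ : ∀ Y : Finset (ZdEdge d), {s | walkEdges (σ s) = Y}.Finite)
    (hpos : ∀ s, 0 < (σ s).length) (X : Finset (ZdEdge d)) :
    {i : Site d × S | walkEdges (shapeLoop σ i).walk = X}.Finite := by
  classical
  set C : Finset (Site d) := X.image Prod.fst ∪ X.image (fun e => e.1 + Pi.single e.2 1) with hC
  have hfin : (⋃ b ∈ (C : Set (Site d)),
      (fun s => (b, s)) '' {s | walkEdges (σ s) = X.image (fun e => (e.1 - b, e.2))}).Finite :=
    (Finset.finite_toSet C).biUnion fun b _ => (hσ _).image _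
  refine hfin.subset ?_
  rintro ⟨x, s⟩ hX
  change walkEdges (shapeLoop σ (x, s)).walk = X at hX
  -- the base point `0 + x` is an endpoint of a link of `X`
  have hlen : 0 < (shapeLoop σ (x, s)).walk.length := by rw [length_shapeLoop]; exact hpos s
  obtain ⟨e, he, hbase⟩ := exists_mem_walkEdges_base (shapeLoop σ (x, s)).walk hlen
  rw [hX] at he
  have hx : x ∈ C := by
    have h0 : (shapeLoop σ (x, s)).base = x := zero_add x
    rw [h0] at hbase
    rcases hbase with h | h
    · exact Finset.mem_union_left _ (Finset.mem_image.2 ⟨e, he, h.symm⟩)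
    · exact Finset.mem_union_right _ (Finset.mem_image.2 ⟨e, he, h.symm⟩)
  -- the shape has edge set `X - x`
  have hs : walkEdges (σ s) = X.image (fun e => (e.1 - x, e.2)) := by
    rw [← hX, walkEdges_shapeLoop, Finset.image_image]
    symm
    convert Finset.image_id (s := walkEdges (σ s)) using 2
    funext e
    simp
  simp only [Set.mem_iUnion, Set.mem_image, Set.mem_setOf_eq, Finset.mem_coe]
  exact ⟨x, hx, s, hs, rfl⟩

end Family

/-! ### The norm of a translation-invariant family -/

section Norm

variable {σ : S → (zdGraph d).Walk (0 : Site d) 0} {w ε : ℝ} {D₀ : S → ℝ} {c₀ : S → ℝ}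

/-- **At most `|σ s|` translates of a shape pass through a link**: the base points `x` (in any finite set) with
`e ∈ x + σ s` inject into the edge set of `σ s` via `x ↦ e − x`. -/
theorem card_filter_mem_shapeLoop_le [DecidableEq (Site d)] (e : ZdEdge d) (s : S) (F : Finset (Site d)) :
    (F.filter fun x => e ∈ walkEdges (shapeLoop σ (x, s)).walk).card ≤ (σ s).length := by
  classical
  refine le_trans ?_ (card_walkEdges_le_length (σ s))
  refine Finset.card_le_card_of_injOn (fun x => ((e.1 - x, e.2) : ZdEdge d)) (fun x hx => ?_) (fun x _ x' _ h => ?_)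
  · rw [Finset.coe_filter, Set.mem_setOf_eq] at hx
    exact (mem_walkEdges_shapeLoop_iff σ (x, s) e).1 hx.2
  · have h1 := congrArg Prod.fst h
    simpa using h1

/-- **THE NORM OF A TRANSLATION-INVARIANT FAMILY**: if the links of each shape are pairwise within `ℓ^∞`-distance
`D₀(s)` and `∑_s |c₀(s)| |σ s|² e^{w D₀(s)} ≤ ε` (`w ≥ 0`), then the translated family with couplings `c₀ ∘ snd` has
loop-action norm `≤ ε`. -/
theorem loopNormLE_shapeLoop (hw : 0 ≤ w)
    (hD₀ : ∀ s, ∀ e ∈ walkEdges (σ s), ∀ y ∈ walkEdges (σ s), ‖e.1 - y.1‖ ≤ D₀ s)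
    (hsum : Summable fun s => |c₀ s| * (σ s).length ^ 2 * exp (w * D₀ s))
    (hε : ∑' s, |c₀ s| * (σ s).length ^ 2 * exp (w * D₀ s) ≤ ε) :
    LoopNormLE w (shapeLoop σ) (fun i => c₀ i.2) ε := by
  classical
  have hg0 : ∀ s, 0 ≤ |c₀ s| * (σ s).length ^ 2 * exp (w * D₀ s) := fun s => by positivity
  have hε0 : 0 ≤ ε := (tsum_nonneg hg0).trans hε
  -- diameter bounds transfer to the translates
  have hD : ∀ i : Site d × S, ∀ e ∈ walkEdges (shapeLoop σ i).walk, ∀ y ∈ walkEdges (shapeLoop σ i).walk,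
      ‖e.1 - y.1‖ ≤ D₀ i.2 := by
    intro i e he y hy
    have h := hD₀ i.2 _ ((mem_walkEdges_shapeLoop_iff σ i e).1 he) _ ((mem_walkEdges_shapeLoop_iff σ i y).1 hy)
    simpa [sub_sub_sub_cancel_right] using h
  -- the dominating family in diameter form and its partial sums
  set g : ZdEdge d → Site d × S → ℝ := fun e i =>
    if e ∈ walkEdges (shapeLoop σ i).walk then |c₀ i.2| * (shapeLoop σ i).walk.length * exp (w * D₀ i.2) else 0
    with hgdef
  have hgnn : ∀ e i, 0 ≤ g e i := fun e i => by
    simp only [hgdef]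
    split_ifs
    · positivity
    · exact le_rfl
  have hpartial : ∀ (e : ZdEdge d) (F : Finset (Site d × S)), ∑ i ∈ F, g e i ≤ ε := by
    intro e F
    have hsub : F ⊆ F.image Prod.fst ×ˢ F.image Prod.snd := Finset.subset_product
    calc ∑ i ∈ F, g e i ≤ ∑ i ∈ F.image Prod.fst ×ˢ F.image Prod.snd, g e i :=
          Finset.sum_le_sum_of_subset_of_nonneg hsub fun i _ _ => hgnn e i
      _ = ∑ s ∈ F.image Prod.snd, ∑ x ∈ F.image Prod.fst, g e (x, s) := by
          rw [Finset.sum_product, Finset.sum_comm]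
      _ ≤ ∑ s ∈ F.image Prod.snd, |c₀ s| * (σ s).length ^ 2 * exp (w * D₀ s) := by
          refine Finset.sum_le_sum fun s _ => ?_
          have heq : ∀ x ∈ F.image Prod.fst, g e (x, s) =
              if e ∈ walkEdges (shapeLoop σ (x, s)).walk then |c₀ s| * (σ s).length * exp (w * D₀ s) else 0 := by
            intro x _
            simp only [hgdef, length_shapeLoop]
          rw [Finset.sum_congr rfl heq, ← Finset.sum_filter, Finset.sum_const, nsmul_eq_mul]
          have hc := card_filter_mem_shapeLoop_le (σ := σ) e s (F.image Prod.fst)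
          have hK : 0 ≤ |c₀ s| * (σ s).length * exp (w * D₀ s) := by positivity
          calc ((F.image Prod.fst).filter fun x => e ∈ walkEdges (shapeLoop σ (x, s)).walk).card *
                (|c₀ s| * (σ s).length * exp (w * D₀ s))
              ≤ (σ s).length * (|c₀ s| * (σ s).length * exp (w * D₀ s)) :=
                mul_le_mul_of_nonneg_right (by exact_mod_cast hc) hK
            _ = |c₀ s| * (σ s).length ^ 2 * exp (w * D₀ s) := by ring
      _ ≤ ∑' s, |c₀ s| * (σ s).length ^ 2 * exp (w * D₀ s) := hsum.sum_le_tsum _ fun s _ => hg0 s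
      _ ≤ ε := hε
  exact loopNormLE_of_diam hw hε0 hD (fun e => summable_of_sum_le (hgnn e) (hpartial e))
    fun e => Real.tsum_le_of_sum_le (hgnn e) (hpartial e)

/-- **Mass gap for translation-invariant generalized Wilson actions**, from any tier-2 row: finite shape fibres,
nontrivial shapes, and `∑_s |c₀(s)| |σ s|² e^{w D₀(s)} ≤ ε`. -/
theorem perturbedMassGapAtS_shapeLoop {β : ℝ} (hrow : MassGapOnBallZdS d N β (2 * ε) ε w) (hw : 0 ≤ w)
    (hσ : ∀ Y : Finset (ZdEdge d), {s | walkEdges (σ s) = Y}.Finite) (hpos : ∀ s, 0 < (σ s).length)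
    (hD₀ : ∀ s, ∀ e ∈ walkEdges (σ s), ∀ y ∈ walkEdges (σ s), ‖e.1 - y.1‖ ≤ D₀ s)
    (hsum : Summable fun s => |c₀ s| * (σ s).length ^ 2 * exp (w * D₀ s))
    (hε : ∑' s, |c₀ s| * (σ s).length ^ 2 * exp (w * D₀ s) ≤ ε) :
    PerturbedMassGapAtS d N β (loopFamilyAction (d := d) N (shapeLoop σ) fun i => c₀ i.2) :=
  perturbedMassGapAtS_loopFamilyAction hrow (finite_fibre_shapeLoop σ hσ hpos) (loopNormLE_shapeLoop hw hD₀ hsum hε)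

end Norm

/-! ### All nontrivial closed trail shapes -/

section Trails

variable (d) in
/-- Index of ALL nontrivial closed trail SHAPES: closed trails of positive length based at the origin. -/
abbrev TrailShape : Type := {s : (zdGraph d).Walk (0 : Site d) 0 // s.IsTrail ∧ 0 < s.length}

/-- **The shape map of the closed trail shapes** (inclusion). -/
def trailShape (s : TrailShape d) : (zdGraph d).Walk (0 : Site d) 0 := s.1

/-- The closed trail shapes have finite edge-set fibres (a trail with edge set `Y` has length `|Y|`). -/
theorem finite_fibre_trailShape (Y : Finset (ZdEdge d)) : {s : TrailShape d | walkEdges (trailShape s) = Y}.Finite := by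
  classical
  have hT : {s : (zdGraph d).Walk (0 : Site d) 0 | s.length = Y.card}.Finite :=
    (Finset.finite_toSet ((zdGraph d).finsetWalkLength Y.card (0 : Site d) 0)).subset fun s hs => by
      rw [Finset.mem_coe, mem_finsetWalkLength_iff]; exact hs
  refine (hT.preimage (Subtype.val_injective.injOn)).subset ?_
  rintro ⟨s, htr, hlen⟩ hY
  change walkEdges s = Y at hY
  change s.length = Y.card
  rw [← hY, card_walkEdges_of_isTrail htr]

/-- Every closed trail shape is nontrivial. -/
theorem length_trailShape_pos (s : TrailShape d) : 0 < (trailShape s).length := s.2.2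

/-- Links of a shape are within `ℓ^∞`-distance `2|s|`. -/
theorem norm_sub_le_trailShape (s : TrailShape d) : ∀ e ∈ walkEdges (trailShape s), ∀ y ∈ walkEdges (trailShape s),
    ‖e.1 - y.1‖ ≤ 2 * ((trailShape s).length : ℝ) :=
  fun _ he _ hy => norm_sub_le_two_mul_length_of_mem_walkEdges _ he hy

/-- `e^{(log q)(2n)} = (q²)^n` for `q > 0`. -/
theorem exp_log_mul_two_mul {q : ℝ} (hq : 0 < q) (n : ℕ) : exp (Real.log q * (2 * (n : ℝ))) = (q ^ 2) ^ n := by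
  rw [show Real.log q * (2 * (n : ℝ)) = ((2 * n : ℕ) : ℝ) * Real.log q by push_cast; ring, Real.exp_nat_mul,
    Real.exp_log hq, pow_mul]

/-- **`SU(2)`, `d = 4`, `β_W = 1/16` — EVERY translation-invariant generalized Wilson action over ALL closed trail
shapes with `∑_s |c₀(s)| |s|² 4^{|s|} ≤ 0.143`** has a unique DLR state with exponential clustering
(row `su2_rowBS2_1_16`; weight `2^{dist}`, shape extent `2|s|`). -/
theorem su2_trailShapes_massGapS_1_16 {c₀ : TrailShape 4 → ℝ}
    (hsum : Summable fun s => |c₀ s| * (trailShape s).length ^ 2 * (4 : ℝ) ^ (trailShape s).length)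
    (hε : ∑' s, |c₀ s| * (trailShape s).length ^ 2 * (4 : ℝ) ^ (trailShape s).length ≤ 143 / 1000) :
    PerturbedMassGapAtS 4 2 ((1 / 16 : ℝ) / 4) (loopFamilyAction (d := 4) 2 (shapeLoop trailShape) fun i => c₀ i.2) := by
  have hexp : ∀ s : TrailShape 4, exp (Real.log 2 * (2 * ((trailShape s).length : ℝ))) = (4 : ℝ) ^ (trailShape s).length :=
    fun s => by rw [exp_log_mul_two_mul (by norm_num : (0 : ℝ) < 2)]; norm_num
  refine perturbedMassGapAtS_shapeLoop su2_rowBS2_1_16 (Real.log_nonneg (by norm_num)) finite_fibre_trailShape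
    length_trailShape_pos norm_sub_le_trailShape (D₀ := fun s => 2 * ((trailShape s).length : ℝ)) ?_ ?_
  · exact hsum.congr fun s => by rw [hexp]
  · calc ∑' s, |c₀ s| * ((trailShape s).length : ℝ) ^ 2 * exp (Real.log 2 * (2 * ((trailShape s).length : ℝ)))
        = ∑' s, |c₀ s| * ((trailShape s).length : ℝ) ^ 2 * (4 : ℝ) ^ (trailShape s).length :=
          tsum_congr fun s => by rw [hexp]
      _ ≤ 143 / 1000 := hε

/-- **Every `N ≥ 2`, `d = 4`, 't Hooft `1/64` — translation-invariant actions over all closed trail shapes with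
`∑_s |c₀(s)| |s|² (36/25)^{|s|} ≤ 1/40`** have the mass gap, `N`-uniformly (row `suN_rowS_1_64`; weight `(6/5)^{dist}`). -/
theorem suN_trailShapes_massGapS_1_64 {N : ℕ} (hN : 2 ≤ N) {c₀ : TrailShape 4 → ℝ}
    (hsum : Summable fun s => |c₀ s| * (trailShape s).length ^ 2 * (36 / 25 : ℝ) ^ (trailShape s).length)
    (hε : ∑' s, |c₀ s| * (trailShape s).length ^ 2 * (36 / 25 : ℝ) ^ (trailShape s).length ≤ 1 / 40) :
    PerturbedMassGapAtS 4 N (1 / 64) (loopFamilyAction (d := 4) N (shapeLoop trailShape) fun i => c₀ i.2) := by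
  have hexp : ∀ s : TrailShape 4,
      exp (Real.log (6 / 5) * (2 * ((trailShape s).length : ℝ))) = (36 / 25 : ℝ) ^ (trailShape s).length :=
    fun s => by rw [exp_log_mul_two_mul (by norm_num : (0 : ℝ) < 6 / 5)]; norm_num
  have hnorm : LoopNormLE (Real.log (6 / 5)) (shapeLoop trailShape) (fun i : Site 4 × TrailShape 4 => c₀ i.2) (1 / 40) := by
    refine loopNormLE_shapeLoop (Real.log_nonneg (by norm_num)) norm_sub_le_trailShape
      (D₀ := fun s => 2 * ((trailShape s).length : ℝ)) ?_ ?_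
    · exact hsum.congr fun s => by rw [hexp]
    · calc ∑' s, |c₀ s| * ((trailShape s).length : ℝ) ^ 2 * exp (Real.log (6 / 5) * (2 * ((trailShape s).length : ℝ)))
          = ∑' s, |c₀ s| * ((trailShape s).length : ℝ) ^ 2 * (36 / 25 : ℝ) ^ (trailShape s).length :=
            tsum_congr fun s => by rw [hexp]
        _ ≤ 1 / 40 := hε
  exact suN_loopFamily_massGapS_1_64 hN (finite_fibre_shapeLoop trailShape finite_fibre_trailShape length_trailShape_pos)
    hnorm

end Trails

end Summit.Ventures.YMGap.RobustBall

end
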